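import Summits.AnomalousDissipation.AnomalousDissipation.Theorems.BaireTransferRobustLoudUpgradeLine
import Literature.Analysis.FunctionSpaces.TorusTrigPoly
import Literature.Analysis.FluidPDE.LerayProjectorTorusProofs

/-!
# Stub `stub_borderedCone` of the line `malkin-cone-group-orbits` (crux stmt-AnomalousDissipation-1144),
# part A: characters along a lattice flow, the phase action, zero mean of symmetry-breaking vectors, and the
# abstract Malkin cone `mem_closure_interior_of_bordered`

Registered stub (proved in `BaireTransferRobustLoudUpgradeStubBorderedCone.lean`, which imports this file):
`theorem stub_borderedCone : ∀ (S : Finset (Fin 3 → ℤ)) (a E ε : ℝ),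
borderedSteady S a E ε ⊆ closure (interior (loud S a E ε))`.
This part file proves the registered sub-goal `borderedCone_partA` (= `mem_closure_interior_of_bordered` in
Pi-form): the FINITE-DIMENSIONAL half of the Malkin lever (Vanderbauwhede 1982 Ch. 8; Dancer 1984; Chossat–
Lauterbach 2000 Ch. 7), which needs no Lyapunov–Schmidt reduction along the group orbit and no Malkin /
cokernel function.  Let `A ⊆ P_S` be a union of `T³`-orbits of the phase action `(b·e) k = e_k(b) e k`, `c`
`dir`-invariant, `d` `dir`-breaking, and `σ` a real function on a ball around `c`, continuous, with `σ c = 0`,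
`Dσ(c) = ℓ`, `ℓ d = 1`, such that EVERY corrected parameter `c' − σ(c') d` lies in `A` (this is what the
implicit function theorem for the steady Navier–Stokes map BORDERED by the visible breaking force `f_d` and a
phase condition delivers: the class `borderedSteady`).  Then for `d''` near `d` and small `s > 0` the continuous
function `θ ↦ σ(c + s (θ·dir)·d'')` is `> 0` at `θ = 0` and `< 0` at a `θ₁` where the ZERO-MEAN character sum
`θ ↦ ℓ((θ·dir)·d)` is negative (§3: only modes with `k·dir ≠ 0` occur; average over roots of unity), so it
vanishes at some `θ*` (intermediate value theorem); `c + s (θ*·dir)·d'' = (θ*·dir)·(c + s d'')` lies in `A`,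
hence so does `c + s d''`, and the cone engine `mem_closure_interior_of_cone` gives `c ∈ closure (interior A)`.

Contents: §1 characters along the flow `θ ↦ θ·dir`; §2 the phase action (notation for a lambda term; pattern
of `Cruxes/RobustLoudUpgrade/Disproof.lean` §11) and `f_{b·e} = f_e(· + b)`; §3 zero mean along the orbit and
the strict sign change `exists_neg_on_orbit_of_breaking`; §4 `mem_closure_interior_of_bordered` and its
registered Pi-form `borderedCone_partA`.  Pure proof file (no definitions).
-/

-- `Summit.<Summit>.<Problem>` is the tree's mandated summit-side namespace (CONVENTIONS §2); for this
-- single-conjunct summit the two coincide, so the duplicate is deliberate.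
set_option linter.dupNamespace false

noncomputable section

open scoped BigOperators Topology
open Filter Set Function TopologicalSpace MeasureTheory

namespace Summit.AnomalousDissipation.AnomalousDissipation.Theorems.RobustLoudUpgrade.BorderedCone

open Literature.Analysis.FunctionSpaces Literature.Analysis.FunctionSpaces.Torus
open Literature.Analysis.FluidPDE
open Summit.AnomalousDissipation.AnomalousDissipation.Theses.BaireTransfer
open UnitAddTorus

/-- The flat unit torus `T³`. -/
local notation "𝕋³" => UnitAddTorus (Fin 3)
/-- Real velocity values. -/
local notation "ℝ³" => EuclideanSpace ℝ (Fin 3)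
/-- Complex Fourier coefficients / complexified velocity values. -/
local notation "ℂ³" => EuclideanSpace ℂ (Fin 3)

variable {S : Finset (Fin 3 → ℤ)}

/-! ## §1 Characters along the lattice flow `θ ↦ θ·dir (mod ℤ³)` -/

/-- `e_k(θ·dir mod ℤ³) = exp(2πi θ (k·dir))`. [folklore] -/
theorem mFourier_flow (k dir : Fin 3 → ℤ) (θ : ℝ) :
    mFourier k (fun i => (((θ * (dir i : ℝ) : ℝ)) : UnitAddCircle)) =
      Complex.exp (2 * Real.pi * Complex.I * (θ : ℂ) * ((idot k dir : ℤ) : ℂ)) := by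
  simp only [mFourier, ContinuousMap.coe_mk, fourier_coe_apply]
  rw [← Complex.exp_sum]
  congr 1
  simp only [idot]
  push_cast
  rw [Finset.mul_sum]
  refine Finset.sum_congr rfl fun i _ => ?_
  ring

/-- Characters have modulus one. [folklore] -/
theorem norm_mFourier_apply (k : Fin 3 → ℤ) (b : 𝕋³) : ‖mFourier k b‖ = 1 := by
  simp only [mFourier, ContinuousMap.coe_mk, norm_prod, fourier_apply, Circle.norm_coe,
    Finset.prod_const_one]

/-! ## §2 The phase action of `T³` on coefficient vectors (pattern from Cruxes/RobustLoudUpgrade/Disproof.lean §11)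

To keep this support file definition-free, the phase action `(b·e) k = e_k(b) • e k` and the flow point
`θ·dir (mod ℤ³)` are NOTATIONS for explicit lambda terms. -/

/-- The phase action of `b ∈ T³` on `P_S`: `(b·e) k = e_k(b) • e k` (notation for a lambda term). -/
local notation "phase[" b "] " e:arg => (fun k => mFourier (Subtype.val k) b • e k)

/-- The lattice flow point `θ·dir (mod ℤ³) ∈ T³` (notation for a lambda term). -/
local notation "flow[" dir "] " θ:arg =>
  (fun i : Fin 3 => ((((θ : ℝ) * ((dir : Fin 3 → ℤ) i : ℝ) : ℝ)) : UnitAddCircle))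

/-- `coeffExt` of a phased vector. [folklore] -/
theorem coeffExt_phase (b : 𝕋³) (e : Coeff S) (k : Fin 3 → ℤ) :
    coeffExt S (phase[b] e) k = mFourier k b • coeffExt S e k := by
  by_cases hk : k ∈ S
  · rw [coeffExt_of_mem _ hk, coeffExt_of_mem _ hk]
  · rw [coeffExt_of_not_mem _ hk, coeffExt_of_not_mem _ hk, smul_zero]

/-- The Leray multiplier is `ℂ`-homogeneous (pattern from Disproof.lean §2). [folklore] -/
theorem lerayCoeff_smul (k : Fin 3 → ℤ) (a : ℂ) (v : ℂ³) :
    Torus.lerayCoeff k (a • v) = a • Torus.lerayCoeff k v := by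
  by_cases hk : k = 0
  · subst hk; simp
  · rw [Torus.lerayCoeff_of_ne_zero hk, Torus.lerayCoeff_of_ne_zero hk, Torus.leraySym_smul]

/-- **`f_{b·e} = f_e(· + b)`** (pattern from Disproof.lean §11 `force_phase`). [folklore] -/
theorem force_phase (b : 𝕋³) (e : Coeff S) : force S (phase[b] e) = fun y => force S e (y + b) := by
  funext y
  rw [force, force, realTrigPoly_apply, realTrigPoly_apply, trigPoly_apply, trigPoly_apply]
  congr 1
  refine Finset.sum_congr rfl fun k _ => ?_
  rw [coeffExt_phase, lerayCoeff_smul, smul_smul, mFourier_apply_add]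

/-- The phase action is additive. [folklore] -/
theorem phase_add (b : 𝕋³) (e e' : Coeff S) : phase[b] (e + e') = phase[b] e + phase[b] e' := by
  funext k
  simp only [Pi.add_apply, smul_add]

/-- The phase action commutes with real scalars. [folklore] -/
theorem phase_smul (b : 𝕋³) (s : ℝ) (e : Coeff S) : phase[b] (s • e) = s • phase[b] e := by
  funext k
  simp only [Pi.smul_apply, smul_comm s]

/-- The phase action is isometric for the sup norm of `P_S`. [folklore] -/
theorem norm_phase (b : 𝕋³) (e : Coeff S) : ‖phase[b] e‖ = ‖e‖ := by
  have hk : ∀ k : ↥S, ‖mFourier (Subtype.val k) b • e k‖ = ‖e k‖ := fun k => by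
    rw [norm_smul, norm_mFourier_apply, one_mul]
  apply le_antisymm
  · exact (pi_norm_le_iff_of_nonneg (norm_nonneg _)).2 fun k => (hk k).le.trans (norm_le_pi_norm e k)
  · refine (pi_norm_le_iff_of_nonneg (norm_nonneg _)).2 fun k => ?_
    rw [← hk k]
    exact norm_le_pi_norm (fun k => mFourier (Subtype.val k) b • e k) k

/-- The phase action is jointly continuous in `(b, e)`; in particular continuous in `b`. [folklore] -/
theorem continuous_phase_left (e : Coeff S) : Continuous fun b : 𝕋³ => phase[b] e :=
  continuous_pi fun k => ((mFourier (Subtype.val k)).continuous).smul continuous_const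

/-- The flow `θ ↦ θ·dir (mod ℤ³)` is continuous. [folklore] -/
theorem continuous_flow (dir : Fin 3 → ℤ) : Continuous fun θ : ℝ => flow[dir] θ :=
  continuous_pi fun i =>
    (continuous_quotient_mk'.comp (continuous_id.mul continuous_const) : Continuous fun θ : ℝ =>
      ((((θ : ℝ) * ((dir : Fin 3 → ℤ) i : ℝ) : ℝ)) : UnitAddCircle))

/-- **An `dir`-invariant coefficient vector is fixed by the phases of the flow**: every active mode has
`k·dir = 0`. [folklore] -/
theorem phase_flow_of_mem_invariantAlong {dir : Fin 3 → ℤ} {c : Coeff S} (hc : c ∈ invariantAlong S dir)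
    (θ : ℝ) : phase[flow[dir] θ] c = c := by
  funext k
  by_cases hk : c k = 0
  · simp only [hk, smul_zero]
  · have h0 : idot k dir = 0 := hc k hk
    simp only [mFourier_flow, h0, Int.cast_zero, mul_zero, Complex.exp_zero, one_smul]

/-- **An `dir`-invariant force is invariant under the flow translations.** [folklore] -/
theorem force_flow_of_mem_invariantAlong {dir : Fin 3 → ℤ} {c : Coeff S} (hc : c ∈ invariantAlong S dir)
    (θ : ℝ) (y : 𝕋³) : force S c (y + flow[dir] θ) = force S c y := by
  have h := force_phase (flow[dir] θ) c
  rw [phase_flow_of_mem_invariantAlong hc θ] at h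
  exact (congrFun h y).symm

/-! ## §3 The finite character structure along the flow: zero mean for symmetry-BREAKING vectors

For `d ∈ breakingAlong S dir` every active mode of `d` has `k·dir ≠ 0`, so `θ ↦ (θ·dir)·d` is a vector
trigonometric polynomial in `θ` without constant term; its average over the `N`-th roots of unity
(`N > max |k·dir|`) vanishes, hence so does the average of `θ ↦ ℓ((θ·dir)·d)` for every real-linear
functional `ℓ` (the Malkin function of the brief is such an `ℓ`), and a functional with `ℓ d > 0` takes
a NEGATIVE value somewhere on the orbit. -/

/-- A non-trivial `N`-th root of unity `ζ = exp(2πi n/N)`, `0 < |n| < N`, has `∑_{j<N} ζ^j = 0`. [folklore] -/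
theorem geom_sum_rootOfUnity_eq_zero {n : ℤ} {N : ℕ} (hn : n ≠ 0) (hnN : n.natAbs < N) :
    ∑ j ∈ Finset.range N, Complex.exp (2 * Real.pi * Complex.I * ((n : ℂ) / (N : ℂ))) ^ j = 0 := by
  have hNpos : 0 < N := lt_of_le_of_lt (Nat.zero_le _) hnN
  have hN0 : (N : ℂ) ≠ 0 := by exact_mod_cast hNpos.ne'
  set ζ : ℂ := Complex.exp (2 * Real.pi * Complex.I * ((n : ℂ) / (N : ℂ))) with hζ
  have hζN : ζ ^ N = 1 := by
    rw [hζ, ← Complex.exp_nat_mul]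
    have : (N : ℂ) * (2 * Real.pi * Complex.I * ((n : ℂ) / (N : ℂ))) = (n : ℂ) * (2 * Real.pi * Complex.I) := by
      field_simp
    rw [this, Complex.exp_int_mul_two_pi_mul_I]
  have hζ1 : ζ ≠ 1 := by
    intro h1
    rw [hζ, Complex.exp_eq_one_iff] at h1
    obtain ⟨m, hm⟩ := h1
    have h2pi : (2 * Real.pi * Complex.I : ℂ) ≠ 0 := by
      simp [Real.pi_ne_zero, Complex.I_ne_zero]
    have hdiv : (n : ℂ) / (N : ℂ) = (m : ℂ) :=
      mul_right_cancel₀ h2pi (by linear_combination hm)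
    have hnm : (n : ℂ) = (m : ℂ) * (N : ℂ) := by
      rw [div_eq_iff hN0] at hdiv; exact hdiv
    have hnm' : n = m * (N : ℤ) := by exact_mod_cast hnm
    have hm0 : m ≠ 0 := by
      rintro rfl; simp at hnm'; exact hn hnm'
    have : (N : ℤ) ≤ |n| := by
      rw [hnm', abs_mul, Nat.abs_cast]
      exact le_mul_of_one_le_left (by positivity) (Int.one_le_abs hm0)
    rw [← Int.natCast_natAbs] at this
    omega
  rw [geom_sum_eq hζ1, hζN, sub_self, zero_div]

/-- **Zero mean along the orbit (discrete form).** For a symmetry-breaking `d` and `N` exceeding every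
`|k·dir|`, `k ∈ S`, the sum of the phased vectors `((j/N)·dir)·d`, `j < N`, vanishes. [folklore] -/
theorem sum_phase_flow_eq_zero {dir : Fin 3 → ℤ} {d : Coeff S} (hd : d ∈ breakingAlong S dir) {N : ℕ}
    (hN : ∀ k : ↥S, (idot k dir).natAbs < N) :
    ∑ j ∈ Finset.range N, phase[flow[dir] ((j : ℝ) / (N : ℝ))] d = 0 := by
  funext k
  rw [Finset.sum_apply, Pi.zero_apply]
  by_cases h0 : idot k dir = 0
  · have hdk : d k = 0 := hd k h0
    simp only [hdk, smul_zero, Finset.sum_const_zero]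
  · have hNpos : 0 < N := lt_of_le_of_lt (Nat.zero_le _) (hN k)
    have hN0 : (N : ℂ) ≠ 0 := by exact_mod_cast hNpos.ne'
    have hterm : ∀ j : ℕ, mFourier (Subtype.val k) (flow[dir] ((j : ℝ) / (N : ℝ))) • d k =
        Complex.exp (2 * Real.pi * Complex.I * (((idot k dir : ℤ) : ℂ) / (N : ℂ))) ^ j • d k := by
      intro j
      rw [mFourier_flow, ← Complex.exp_nat_mul]
      congr 2
      push_cast
      field_simp
    simp only [hterm]
    rw [← Finset.sum_smul, geom_sum_rootOfUnity_eq_zero h0 (hN k), zero_smul]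

/-- The phases of the flow at `θ = 0` act trivially. [folklore] -/
theorem phase_flow_zero (dir : Fin 3 → ℤ) (e : Coeff S) : phase[flow[dir] (0 : ℝ)] e = e := by
  funext k
  rw [mFourier_flow]
  simp

/-- **A real-linear functional positive at a symmetry-breaking `d` is negative somewhere on its orbit**
(zero mean ⇒ strict sign change; the Malkin function `θ ↦ ⟨ψ₀, f_{(θ·dir)·d}⟩` is the case in point).
[folklore] -/
theorem exists_neg_on_orbit_of_breaking {dir : Fin 3 → ℤ} {d : Coeff S} (hd : d ∈ breakingAlong S dir)
    (ℓ : Coeff S →L[ℝ] ℝ) (hℓ : 0 < ℓ d) : ∃ θ : ℝ, ℓ (phase[flow[dir] θ] d) < 0 := by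
  by_contra h
  push Not at h
  set N : ℕ := (Finset.univ : Finset ↥S).sup (fun k => (idot k dir).natAbs) + 1 with hNdef
  have hN : ∀ k : ↥S, (idot k dir).natAbs < N := fun k =>
    Nat.lt_succ_of_le (Finset.le_sup (f := fun k : ↥S => (idot k dir).natAbs) (Finset.mem_univ k))
  have hsum := congrArg ℓ (sum_phase_flow_eq_zero hd hN)
  rw [map_sum, map_zero] at hsum
  have h0mem : (0 : ℕ) ∈ Finset.range N := Finset.mem_range.2 (Nat.succ_pos _)
  have hle := Finset.single_le_sum (f := fun j : ℕ => ℓ (phase[flow[dir] ((j : ℝ) / (N : ℝ))] d))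
    (fun j _ => h _) h0mem
  have hz : ((0 : ℕ) : ℝ) / (N : ℝ) = 0 := by simp
  simp only [hsum] at hle
  rw [hz, phase_flow_zero] at hle
  exact absurd hle (not_le.2 hℓ)

/-! ## §4 The Malkin cone: from a BORDERED persistence at `u₀` to `c ∈ closure (interior A)`

Pure finite-dimensional analysis.  `A ⊆ P_S` is any set that is a union of `T³`-orbits (for `A = loud` this
is Disproof.lean §11, re-proved in §5 below), `c` is `dir`-invariant, `d` is `dir`-breaking, and `σ` is a
real function on a ball around `c`, continuous, vanishing and differentiable at `c` with `Dσ(c) d = 1`, such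
that EVERY `c'` in the ball becomes good after the correction `c' ↦ c' − σ(c') d` (this is exactly what the
implicit function theorem applied to the steady Navier–Stokes map BORDERED by the unfolding direction `f_d`
and a phase condition produces at a Malkin-visible Goldstone steady state; see §6).  Then for `d''` near `d`
and small `s > 0` the continuous function `θ ↦ σ(c + s (θ·dir)·d'')` is `> 0` at `θ = 0` (`Dσ(c) d'' ≈ 1`) and
`< 0` at a `θ₁` where the zero-mean function `θ ↦ Dσ(c)((θ·dir)·d)` is negative (§3); a zero `θ*`
(intermediate value theorem) is a good parameter `c + s (θ*·dir)·d'' = (θ*·dir)·(c + s d'')` on the ORBIT of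
`c + s d''`, so `c + s d''` is good, and the cone engine `mem_closure_interior_of_cone` concludes. -/

/-- **The Malkin cone, abstract form.** [folklore] -/
theorem mem_closure_interior_of_bordered {A : Set (Coeff S)} {c d : Coeff S} {dir : Fin 3 → ℤ}
    (hA : ∀ (b : 𝕋³) (e : Coeff S), phase[b] e ∈ A → e ∈ A)
    (hc : c ∈ invariantAlong S dir) (hd : d ∈ breakingAlong S dir)
    {σ : Coeff S → ℝ} {ℓ : Coeff S →L[ℝ] ℝ} {r₀ : ℝ}
    (hσc : σ c = 0) (hσ : HasFDerivAt σ ℓ c) (hℓ : ℓ d = 1) (hr₀ : 0 < r₀)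
    (hcont : ContinuousOn σ (Metric.ball c r₀))
    (hpers : ∀ c' ∈ Metric.ball c r₀, c' - σ c' • d ∈ A) :
    c ∈ closure (interior A) := by
  -- Step 1: a negative value of the linearised Malkin function `θ ↦ ℓ((θ·dir)·d)` on the orbit of `d`
  obtain ⟨θ₁, hθ₁⟩ := exists_neg_on_orbit_of_breaking hd ℓ (by rw [hℓ]; exact one_pos)
  set m₁ : ℝ := -ℓ (phase[flow[dir] θ₁] d) with hm₁
  have hm₁pos : 0 < m₁ := by rw [hm₁]; linarith
  -- constants
  set κ : ℝ := min 1 m₁ with hκ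
  have hκpos : 0 < κ := lt_min one_pos hm₁pos
  have hκ1 : κ ≤ 1 := min_le_left _ _
  have hκm : κ ≤ m₁ := min_le_right _ _
  set M : ℝ := ‖d‖ + 1 with hM
  have hMpos : 0 < M := by positivity
  set L : ℝ := ‖ℓ‖ + 1 with hL
  have hLpos : 0 < L := by positivity
  set r : ℝ := κ / (4 * L) with hr
  have hrpos : 0 < r := by positivity
  have hLr : L * r = κ / 4 := by
    rw [hr]; field_simp
  have hℓr : ‖ℓ‖ * r ≤ κ / 4 := by
    rw [← hLr]
    exact mul_le_mul_of_nonneg_right (by linarith) hrpos.le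
  have hr1 : r ≤ 1 := by
    have h1 : L * r ≤ L * 1 := by rw [hLr, mul_one]; linarith [norm_nonneg ℓ]
    exact le_of_mul_le_mul_left h1 hLpos
  set η : ℝ := κ / (4 * M) with hη
  have hηpos : 0 < η := by positivity
  have hηM : η * M = κ / 4 := by
    rw [hη]; field_simp
  -- Step 2: the first-order expansion of `σ` at `c` (`σ c = 0`, `Dσ(c) = ℓ`)
  obtain ⟨ρ, hρpos, hρ⟩ : ∃ ρ > 0, ∀ h : Coeff S, ‖h‖ < ρ → ‖σ (c + h) - ℓ h‖ ≤ η * ‖h‖ := by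
    have h1 := (hasFDerivAt_iff_isLittleO_nhds_zero.1 hσ).def hηpos
    rw [Metric.eventually_nhds_iff] at h1
    obtain ⟨ρ, hρ, h2⟩ := h1
    refine ⟨ρ, hρ, fun h hh => ?_⟩
    have := h2 (show dist h 0 < ρ by rwa [dist_zero_right])
    rwa [hσc, sub_zero] at this
  -- Step 3: the truncated cone `c + s • ball d r`, `0 < s < s₀`
  set s₀ : ℝ := min ρ r₀ / M with hs₀
  have hs₀pos : 0 < s₀ := by positivity
  refine mem_closure_interior_of_cone (d := d) hrpos hs₀pos fun s hs hss₀ d'' hd'' => ?_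
  have hd''n : ‖d'' - d‖ < r := by rwa [← dist_eq_norm]
  have hd''M : ‖d''‖ ≤ M := by
    calc ‖d''‖ = ‖d + (d'' - d)‖ := by rw [add_sub_cancel]
      _ ≤ ‖d‖ + ‖d'' - d‖ := norm_add_le _ _
      _ ≤ ‖d‖ + 1 := by linarith
  have hsM : s * M < min ρ r₀ := (lt_div_iff₀ hMpos).1 hss₀
  have hκs4 : η * (s * ‖d''‖) ≤ s * (κ / 4) := by
    calc η * (s * ‖d''‖) = s * (η * ‖d''‖) := by ring
      _ ≤ s * (η * M) := by gcongr
      _ = s * (κ / 4) := by rw [hηM]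
  -- the path `θ ↦ c + s • (θ·dir)·d''` stays in the ball, and `σ` is continuous along it
  have hγ_small : ∀ θ : ℝ, ‖s • phase[flow[dir] θ] d''‖ < ρ := fun θ => by
    rw [norm_smul, Real.norm_of_nonneg hs.le, norm_phase]
    calc s * ‖d''‖ ≤ s * M := by gcongr
      _ < min ρ r₀ := hsM
      _ ≤ ρ := min_le_left _ _
  have hγ_ball : ∀ θ : ℝ, c + s • phase[flow[dir] θ] d'' ∈ Metric.ball c r₀ := fun θ => by
    rw [Metric.mem_ball, dist_eq_norm, add_sub_cancel_left, norm_smul, Real.norm_of_nonneg hs.le,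
      norm_phase]
    calc s * ‖d''‖ ≤ s * M := by gcongr
      _ < min ρ r₀ := hsM
      _ ≤ r₀ := min_le_right _ _
  have hph : Continuous fun θ : ℝ => phase[flow[dir] θ] d'' :=
    (continuous_phase_left d'').comp (continuous_flow dir)
  have hsp : Continuous fun θ : ℝ => s • phase[flow[dir] θ] d'' := hph.const_smul s
  have hγ_cont : Continuous fun θ : ℝ => c + s • phase[flow[dir] θ] d'' := continuous_const.add hsp
  have hg_cont : Continuous fun θ : ℝ => σ (c + s • phase[flow[dir] θ] d'') :=
    hcont.comp_continuous hγ_cont hγ_ball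
  -- sign at `θ = 0`: `σ(c + s d'') ≥ s (ℓ d'' − κ/4) − s κ/4 > 0`
  have hℓd'' : 1 - κ / 4 ≤ ℓ d'' := by
    have h1 : ℓ d'' = ℓ d + ℓ (d'' - d) := by rw [← map_add, add_sub_cancel]
    have h2 : |ℓ (d'' - d)| ≤ ‖ℓ‖ * ‖d'' - d‖ := by
      rw [← Real.norm_eq_abs]; exact ℓ.le_opNorm _
    have h3 : ‖ℓ‖ * ‖d'' - d‖ ≤ ‖ℓ‖ * r := by gcongr
    have h4 := neg_abs_le (ℓ (d'' - d))
    rw [h1, hℓ]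
    linarith
  have hg0 : 0 < σ (c + s • phase[flow[dir] (0 : ℝ)] d'') := by
    rw [phase_flow_zero]
    have hsmall : ‖s • d''‖ < ρ := by simpa only [phase_flow_zero] using hγ_small 0
    have hest := hρ (s • d'') hsmall
    rw [Real.norm_eq_abs, map_smul, norm_smul, Real.norm_of_nonneg hs.le, smul_eq_mul] at hest
    have h5 := (abs_le.1 (hest.trans hκs4)).1
    have h6 : s * (1 - κ / 4) ≤ s * ℓ d'' := mul_le_mul_of_nonneg_left hℓd'' hs.le
    have h7 : s * κ ≤ s * 1 := mul_le_mul_of_nonneg_left hκ1 hs.le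
    linarith
  -- sign at `θ = θ₁`: `σ(c + s (θ₁·dir)·d'') ≤ s (−m₁ + κ/4) + s κ/4 < 0`
  have hgθ₁ : σ (c + s • phase[flow[dir] θ₁] d'') < 0 := by
    have hest := hρ (s • phase[flow[dir] θ₁] d'') (hγ_small θ₁)
    rw [Real.norm_eq_abs, map_smul, norm_smul, Real.norm_of_nonneg hs.le, norm_phase, smul_eq_mul] at hest
    have h1 : ℓ (phase[flow[dir] θ₁] d'') =
        ℓ (phase[flow[dir] θ₁] d) + ℓ (phase[flow[dir] θ₁] (d'' - d)) := by
      rw [← map_add, ← phase_add, add_sub_cancel]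
    have h2 : |ℓ (phase[flow[dir] θ₁] (d'' - d))| ≤ ‖ℓ‖ * ‖d'' - d‖ := by
      rw [← Real.norm_eq_abs, ← norm_phase (flow[dir] θ₁) (d'' - d)]
      exact ℓ.le_opNorm _
    have h3 : ‖ℓ‖ * ‖d'' - d‖ ≤ ‖ℓ‖ * r := by gcongr
    have h4 := le_abs_self (ℓ (phase[flow[dir] θ₁] (d'' - d)))
    have hℓθ : ℓ (phase[flow[dir] θ₁] d'') ≤ -m₁ + κ / 4 := by
      rw [h1]; linarith
    have h5 := (abs_le.1 (hest.trans hκs4)).2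
    have h6 : s * ℓ (phase[flow[dir] θ₁] d'') ≤ s * (-m₁ + κ / 4) := mul_le_mul_of_nonneg_left hℓθ hs.le
    have h7 : s * κ ≤ s * m₁ := mul_le_mul_of_nonneg_left hκm hs.le
    have h8 : 0 < s * m₁ := mul_pos hs hm₁pos
    linarith
  -- intermediate value theorem on the segment between `0` and `θ₁`
  obtain ⟨θs, -, hθs⟩ : ∃ θs ∈ Set.uIcc (0 : ℝ) θ₁, σ (c + s • phase[flow[dir] θs] d'') = 0 := by
    have hmem : (0 : ℝ) ∈ Set.uIcc (σ (c + s • phase[flow[dir] (0 : ℝ)] d''))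
        (σ (c + s • phase[flow[dir] θ₁] d'')) :=
      Set.mem_uIcc.2 (Or.inr ⟨hgθ₁.le, hg0.le⟩)
    exact intermediate_value_uIcc (a := (0 : ℝ)) (b := θ₁) hg_cont.continuousOn hmem
  -- the zero is a good parameter ON THE ORBIT of `c + s • d''` …
  have hmemA : c + s • phase[flow[dir] θs] d'' ∈ A := by
    have := hpers _ (hγ_ball θs)
    rwa [hθs, zero_smul, sub_zero] at this
  -- … so `c + s • d''` itself is good
  refine hA (flow[dir] θs) (c + s • d'') ?_
  rwa [phase_add, phase_smul, phase_flow_of_mem_invariantAlong hc]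


/-- **Registered sub-goal `borderedCone_partA`** (part file of `stub_borderedCone`): the abstract Malkin cone
`mem_closure_interior_of_bordered` in Pi-form. [folklore] -/
theorem borderedCone_partA : ∀ (S : Finset (Fin 3 → ℤ)) (A : Set (Coeff S)) (c d : Coeff S) (dir : Fin 3 → ℤ) (σ : Coeff S → ℝ) (ℓ : Coeff S →L[ℝ] ℝ) (r₀ : ℝ), (∀ (b : UnitAddTorus (Fin 3)) (e : Coeff S), (fun k => UnitAddTorus.mFourier (Subtype.val k) b • e k) ∈ A → e ∈ A) → c ∈ invariantAlong S dir → d ∈ breakingAlong S dir → σ c = 0 → HasFDerivAt σ ℓ c → ℓ d = 1 → 0 < r₀ → ContinuousOn σ (Metric.ball c r₀) → (∀ c' ∈ Metric.ball c r₀, c' - σ c' • d ∈ A) → c ∈ closure (interior A) :=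
  fun _ _ _ _ _ _ _ _ hA hc hd hσc hσ hℓ hr₀ hcont hpers =>
    mem_closure_interior_of_bordered hA hc hd hσc hσ hℓ hr₀ hcont hpers

end Summit.AnomalousDissipation.AnomalousDissipation.Theorems.RobustLoudUpgrade.BorderedCone

end
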